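import Literature.Analysis.Asymptotics.LaplaceMethodChart
import Literature.MeasureTheory.Group.OrbitTubeMeasure
import HarnessLib

/-!
# Laplace's method for an invariant phase with one non-degenerate critical ORBIT
(the Morse–Bott case «minimum set = a group orbit», through a local product chart at one point)

Topic `Analysis/Asymptotics`; namespace `Literature.Analysis.Asymptotics`.  Proof file: one theorem (+ a
`MulAction` restatement), no definitions, no named facts.

THE SETTING (that of `MeasureTheory/Group/OrbitTubeMeasure.lean`, instance-free in the action).  A group `K`
with a finite left- and right-invariant measure `ν` (a compact group and a Haar measure) acts on a measure
space `(X, μ)` by a jointly measurable family `act k` of `μ`-preserving maps; the phase `f` and the amplitude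
`φ` are `act`-INVARIANT measurable functions on `X`.  A transversal `σ : V → X` from a finite-dimensional
real inner product space (Lebesgue measure, dimension `m`) with window `B ⊇ {‖y‖ < r}` gives the tube map
`Θ(k, y) = act k (σ y)` and the tube `T = Θ(K × B)` around the orbit `K • σ(0)`; a local window of group
directions `Θ'(z, y) = act (e z) (σ y)`, `z ∈ Φ ⊆ Z` (any s-finite `(Z, κ)`), carries a LOCAL chart identity
`μ|_{Θ'(Φ×B)} = Θ'_*(((κ ⊗ dy)|_{Φ×B}) · J)` with a real density `J ≥ 0`; the slice property
«`act k (σ y) = σ y'`, `y, y' ∈ B` ⟹ `k ∈ S`» holds for a set `S` fixing `σ(B)` pointwise, and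
`0 < c = ν(((eΦ)·S)⁻¹) < ∞`.

THE RESULT (PROVED): `tendsto_laplaceMethod_orbit`.  If `f∘σ` has a non-degenerate minimum at `0` in the
Peano sense (`f(σ y) = f(σ 0) + ½⟪Ay, y⟫ + o(‖y‖²)`, `A` symmetric positive definite), is separated from
`f(σ 0)` on `B` away from `0` and on `X ∖ T`, the averaged density `j(y) = (∫_Φ J(z, y) dκ(z)) ∕ c` and
`φ∘σ` are continuous at `0` with `j · φ∘σ` bounded near `0`, and `e^{−β₀ f} φ ∈ L¹(μ)`, then

  `β^{m/2} ∫_X e^{−β (f − f(σ 0))} φ dμ ⟶ (2π)^{m/2} · ν(K) · j(0) · φ(σ 0) ∕ √det A`   (`β → ∞`).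

PROOF.  `OrbitTubeMeasure.restrict_tube_eq_map_withDensity_ofReal` globalises the local chart identity to the
fibred chart identity `μ|_T = Θ_*(((ν ⊗ dy)|_{K×B}) · j)` (parameter space the acting group `K`); by
invariance the phase and amplitude in tubular coordinates do not depend on the group coordinate, so the
hypotheses of `tendsto_laplaceMethod_fibred_chart` (uniform Peano expansion, separation, dominated
continuity across the critical manifold `K`) reduce to the stated ONE-POINT data; the limit integral over `K`
of a constant is `ν(K)` times it.

WHY (the use).  The `β → ∞` (zero-temperature ∕ tree-level) limit of compact-group or lattice-gauge integrals
`∫ e^{−βS} O dU` whose action has a non-degenerate critical GAUGE ORBIT: the differential topology (inverse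
function theorem in exponential coordinates and the Haar density of `X` in the chart) is supplied once, at
one point of the orbit, as `hloc`; the stabiliser (`Z_N` for twist eaters) enters only through the constant
`c`.  [Bredon1972, Ch. II §§4–5; DearricottEtAl2014 (Searle) Def. 1.11, (1)–(7) PDF pp. 34–35 (tube
`K ×_S B`); HasenpflugRudolfSprungk2024 App. 4.1 Thm 16 ∕ Hwang1980 (Laplace with a manifold of minima);
Breitung1994 Thm 41 p. 56 with §2.3 (local coordinates).]

HONEST SCOPE.  An asymptotic statement at fixed everything else; nothing uniform in auxiliary parameters
(volume), nothing about lattice gauge theory proper or the Yang–Mills mass gap (Clay), which is NOT proved;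
`R4` closes only the conditional finite-`𝕋⁴` rung `BalabanLadder.UV`.

## References
* E. Hasenpflug, D. Rudolf, B. Sprungk, *Wasserstein convergence rates of increasingly concentrating
  probability measures*, Ann. Appl. Probab. 34 (2024), §3.1 Assumption 3, App. 4.1 Thm 16.
  [HasenpflugRudolfSprungk2024]
* C.-R. Hwang, *Laplace's method revisited: weak convergence of probability measures*, Ann. Probab. 8
  (1980) 1177–1182. [Hwang1980]
* K. W. Breitung, *Asymptotic Approximations for Probability Integrals*, LNM 1592 (1994), Thm 41 p. 56, §2.3.
  [Breitung1994]
* G. E. Bredon, *Introduction to Compact Transformation Groups* (1972), Ch. II §§4–5. [Bredon1972]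
* C. Searle, in Dearricott et al., LNM 2110 (2014), Def. 1.11 and (1)–(7), PDF pp. 34–35. [DearricottEtAl2014]
-/

noncomputable section

open _root_.MeasureTheory _root_.MeasureTheory.Measure _root_.Filter _root_.Set _root_.Module
open scoped _root_.Topology _root_.Real _root_.InnerProductSpace _root_.ENNReal _root_.NNReal _root_.Pointwise

namespace Literature.Analysis.Asymptotics

open Literature.MeasureTheory.Group

variable {V : Type*} [NormedAddCommGroup V] [InnerProductSpace ℝ V] [FiniteDimensional ℝ V]
  [MeasurableSpace V] [BorelSpace V]
variable {K X Z : Type*} [Group K] [MeasurableSpace K] [MeasurableMul K] [MeasurableInv K]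
  [MeasurableSpace X] [MeasurableSpace Z]
  {act : K → X → X} {σ : V → X} {e : Z → K} {Θ : K × V → X} {Θ' : Z × V → X}
  {B : Set V} {Φ : Set Z} {S : Set K}
  {ν : Measure K} [IsMulLeftInvariant ν] [IsMulRightInvariant ν] [IsFiniteMeasure ν]
  {μ : Measure X} [SFinite μ] {κ : Measure Z} [SFinite κ]

/-- ★★ **Laplace's method for an invariant phase with one non-degenerate critical orbit.**  In the setting
of the module docstring (instance-free measurable action `act` of a group `K` preserving `μ`, finite bi-invariant
`ν` on `K`, transversal `σ : V → X` with window `B ⊇ {‖y‖ < r}`, tube `T = Θ(K × B)`, local window `Θ'(Φ × B)`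
with the local chart identity `hloc` for a real density `J ≥ 0`, slice property for a set `S` fixing `σ(B)`,
`0 < ν(((eΦ)·S)⁻¹) < ∞`), for `act`-invariant measurable `f, φ : X → ℝ` with `f(σ y) = f(σ 0) + ½⟪Ay, y⟫ + o(‖y‖²)`
(`A` symmetric positive definite), separation of `f` from `f(σ 0)` on `B ∖ {‖y‖ < δ}` and on `X ∖ T`,
`y ↦ ∫_Φ J(z, y) dκ` and `φ∘σ` continuous at `0` with their product bounded near `0`, and `e^{−β₀ f}φ ∈ L¹(μ)`:
`β^{m/2} ∫_X e^{−β(f − f(σ 0))} φ dμ ⟶ (2π)^{m/2} · ν(K) · ((∫_Φ J(z,0) dκ) ∕ ν(((eΦ)·S)⁻¹)) · φ(σ 0) ∕ √det A`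
(`ν(K)` as the real number `ν.real univ`).
[cite: HasenpflugRudolfSprungk2024, §3.1 Assumption 3 and App. 4.1 Thm 16 (manifold of minimisers; here a group orbit)]
[cite: Hwang1980, main theorem (minimum set a manifold)]
[cite: Breitung1994, Thm 41 p. 56 with §2.3 Definitions 4–5 pp. 14–15 (local coordinates)]
[cite: DearricottEtAl2014, (Searle) Def. 1.11 and properties (1)–(7), PDF pp. 34–35 (the tube `K ×_S B`)]
[cite: Bredon1972, Ch. II §§4–5] -/
theorem tendsto_laplaceMethod_orbit
    (hact : Measurable fun p : K × X => act p.1 p.2)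
    (hmul : ∀ k k' x, act (k * k') x = act k (act k' x)) (hone : ∀ x, act 1 x = x)
    (hpres : ∀ k, MeasurePreserving (act k) μ μ) (hσ : Measurable σ)
    (hΘ : ∀ k y, Θ (k, y) = act k (σ y)) (hΘm : Measurable Θ)
    (hΘ' : ∀ z y, Θ' (z, y) = act (e z) (σ y)) (hΘ'm : Measurable Θ')
    (hslice : ∀ k : K, ∀ y ∈ B, ∀ y' ∈ B, act k (σ y) = σ y' → k ∈ S)
    (hfix : ∀ s ∈ S, ∀ y ∈ B, act s (σ y) = σ y)
    (hT : MeasurableSet (Θ '' (univ ×ˢ B))) (hA : MeasurableSet (Θ' '' (Φ ×ˢ B)))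
    (hB : MeasurableSet B) (hΦ : MeasurableSet Φ) {r : ℝ} (hr : 0 < r) (hrB : Metric.ball (0 : V) r ⊆ B)
    {J : Z × V → ℝ} (hJm : Measurable J) (hJ0 : ∀ z ∈ Φ, ∀ y ∈ B, 0 ≤ J (z, y))
    (hJint : ∀ y ∈ B, IntegrableOn (fun z => J (z, y)) Φ κ)
    (hloc : μ.restrict (Θ' '' (Φ ×ˢ B)) =
      (((κ.prod volume).restrict (Φ ×ˢ B)).withDensity fun w => ENNReal.ofReal (J w)).map Θ')
    (hc0 : ν (((e '' Φ) * S)⁻¹) ≠ 0) (hctop : ν (((e '' Φ) * S)⁻¹) ≠ ∞)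
    {f φ : X → ℝ} {A : V →ₗ[ℝ] V} (hAs : A.IsSymmetric) (hpos : ∀ y, y ≠ 0 → 0 < ⟪A y, y⟫_ℝ)
    (hfm : Measurable f) (hφm : Measurable φ)
    (hfinv : ∀ k x, f (act k x) = f x) (hφinv : ∀ k x, φ (act k x) = φ x)
    (hS2 : (fun y => f (σ y) - f (σ 0) - (1 / 2) * ⟪A y, y⟫_ℝ) =o[𝓝 0] fun y => ‖y‖ ^ 2)
    (hsep : ∀ δ : ℝ, 0 < δ → ∃ η : ℝ, 0 < η ∧ ∀ y ∈ B, δ ≤ ‖y‖ → f (σ 0) + η ≤ f (σ y))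
    (hout : ∃ η₀ : ℝ, 0 < η₀ ∧ ∀ x, x ∉ Θ '' (univ ×ˢ B) → f (σ 0) + η₀ ≤ f x)
    (hj : ContinuousAt (fun y => ∫ z in Φ, J (z, y) ∂κ) 0) (hφc : ContinuousAt (fun y => φ (σ y)) 0)
    {δ₁ C : ℝ} (hδ₁ : 0 < δ₁) (hbound : ∀ y, ‖y‖ < δ₁ → |(∫ z in Φ, J (z, y) ∂κ) * φ (σ y)| ≤ C)
    {β₀ : ℝ} (hint : Integrable (fun x => Real.exp (-β₀ * f x) * φ x) μ) :
    Tendsto (fun β : ℝ => β ^ ((finrank ℝ V : ℝ) / 2) *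
        ∫ x, Real.exp (-β * (f x - f (σ 0))) * φ x ∂μ) atTop
      (𝓝 ((2 * π) ^ ((finrank ℝ V : ℝ) / 2) * (ν.real univ *
        ((∫ z in Φ, J (z, 0) ∂κ) / (ν (((e '' Φ) * S)⁻¹)).toReal * φ (σ 0) /
          Real.sqrt (LinearMap.det A))))) := by
  -- the averaged transversal density `j` and the fibred density `J' (k, y) = j y`
  set c : ℝ≥0∞ := ν (((e '' Φ) * S)⁻¹) with hc
  set j : V → ℝ := fun y => (∫ z in Φ, J (z, y) ∂κ) / c.toReal with hjdef
  have hcpos : 0 < c.toReal := ENNReal.toReal_pos hc0 hctop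
  have hjm : Measurable j := by
    have h1 : StronglyMeasurable fun y => ∫ z, J (z, y) ∂κ.restrict Φ :=
      hJm.stronglyMeasurable.integral_prod_left'
    exact h1.measurable.div_const _
  have hJ'm : Measurable fun z : K × V => j z.2 := hjm.comp measurable_snd
  have hJ'0 : ∀ z ∈ (univ : Set K) ×ˢ B, 0 ≤ j z.2 := by
    rintro ⟨k, y⟩ ⟨-, hy⟩
    exact div_nonneg (setIntegral_nonneg hΦ fun z hz => hJ0 z hz y hy) hcpos.le
  -- ★ the global fibred chart identity (orbit-tube globalisation of `hloc`)
  have hchart : μ.restrict (Θ '' (univ ×ˢ B)) =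
      (((ν.prod volume).restrict (univ ×ˢ B)).withDensity fun z => ENNReal.ofReal (j z.2)).map Θ :=
    restrict_tube_eq_map_withDensity_ofReal hact hmul hone hpres hσ hΘ hΘm hΘ' hΘ'm hslice hfix hT hA hB hΦ
      hJm hJ0 hJint hloc hc0 hctop
  -- coercivity of `A`
  obtain ⟨c₁, hc₁, hcoer⟩ := exists_pos_mul_norm_sq_le_inner hAs hpos
  -- the hypotheses of the fibred chart theorem, reduced to one-point data by invariance
  have hΘf : ∀ k y, f (Θ (k, y)) = f (σ y) := fun k y => by rw [hΘ, hfinv]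
  have hΘφ : ∀ k y, φ (Θ (k, y)) = φ (σ y) := fun k y => by rw [hΘ, hφinv]
  have hS2' : ∀ ε : ℝ, 0 < ε → ∃ δ : ℝ, 0 < δ ∧ ∀ (p : K) (y : V), ‖y‖ < δ →
      |f (Θ (p, y)) - f (σ 0) - (1 / 2) * ⟪A y, y⟫_ℝ| ≤ ε * ‖y‖ ^ 2 := by
    intro ε hε
    have hev := hS2.def hε
    obtain ⟨δ, hδ, h⟩ := Metric.eventually_nhds_iff.1 hev
    refine ⟨δ, hδ, fun p y hy => ?_⟩
    have h1 := h (by rwa [dist_zero_right])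
    rw [Real.norm_eq_abs, Real.norm_eq_abs, abs_of_nonneg (by positivity : (0 : ℝ) ≤ ‖y‖ ^ 2)] at h1
    rwa [hΘf]
  have hsep' : ∀ δ : ℝ, 0 < δ → ∃ η : ℝ, 0 < η ∧ ∀ (p : K) (y : V), (p, y) ∈ (univ : Set K) ×ˢ B →
      δ ≤ ‖y‖ → f (σ 0) + η ≤ f (Θ (p, y)) := by
    intro δ hδ
    obtain ⟨η, hη, h⟩ := hsep δ hδ
    refine ⟨η, hη, fun p y hz hy => ?_⟩
    rw [hΘf]
    exact h y hz.2 hy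
  have hg' : ∀ p : K, ContinuousAt (fun y => j (p, y).2 * φ (Θ (p, y))) 0 := by
    intro p
    simp only [hΘφ]
    exact (hj.div_const _).mul hφc
  have hgG' : ∀ (p : K) (y : V), ‖y‖ < δ₁ → |j (p, y).2 * φ (Θ (p, y))| ≤ |C| / c.toReal := by
    intro p y hy
    rw [hΘφ]
    have h1 := hbound y hy
    simp only [hjdef]
    rw [div_mul_eq_mul_div, abs_div, abs_of_pos hcpos]
    exact div_le_div_of_nonneg_right (h1.trans (le_abs_self C)) hcpos.le
  -- ★ the fibred chart Laplace theorem with parameter space `K`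
  have hmain := tendsto_laplaceMethod_fibred_chart (μ := μ) (ν := ν) (Ψ := Θ) (W := (univ : Set K) ×ˢ B)
    (J := fun z : K × V => j z.2) (f := f) (φ := φ) (f₀ := f (σ 0)) (A := fun _ : K => A)
    (fun _ => hAs) hc₁ (fun _ y => hcoer y) hΘm (MeasurableSet.univ.prod hB) hT hr
    (fun p y hy => ⟨mem_univ p, hrB (by rwa [Metric.mem_ball, dist_zero_right])⟩) hJ'm hJ'0 hchart hfm hφm
    hS2' hsep' hout hg' (integrable_const (|C| / c.toReal)) hδ₁ hgG' hint
  -- the limit: a constant integrated over `K`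
  have hval : (∫ p : K, j (p, (0 : V)).2 * φ (Θ (p, 0)) / Real.sqrt (LinearMap.det A) ∂ν) =
      ν.real univ * ((∫ z in Φ, J (z, 0) ∂κ) / c.toReal * φ (σ 0) / Real.sqrt (LinearMap.det A)) := by
    simp only [hΘφ, hjdef]
    rw [integral_const, smul_eq_mul]
  rw [hval] at hmain
  exact hmain

/-- ★★ **Laplace's method on a non-degenerate critical orbit, `MulAction` form**: the same statement for a
registered measurable action of `K` on `X` preserving `μ` (`SMulInvariantMeasure`), invariant phase and
amplitude. [cite: HasenpflugRudolfSprungk2024, §3.1 Assumption 3 and App. 4.1 Thm 16]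
[cite: Hwang1980, main theorem (minimum set a manifold)]
[cite: DearricottEtAl2014, (Searle) Def. 1.11 and properties (1)–(7), PDF pp. 34–35] -/
theorem tendsto_laplaceMethod_orbit_smul [MulAction K X] [MeasurableSMul₂ K X] [SMulInvariantMeasure K X μ]
    (hσ : Measurable σ)
    (hΘ : ∀ k y, Θ (k, y) = k • σ y) (hΘm : Measurable Θ)
    (hΘ' : ∀ z y, Θ' (z, y) = e z • σ y) (hΘ'm : Measurable Θ')
    (hslice : ∀ k : K, ∀ y ∈ B, ∀ y' ∈ B, k • σ y = σ y' → k ∈ S)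
    (hfix : ∀ s ∈ S, ∀ y ∈ B, s • σ y = σ y)
    (hT : MeasurableSet (Θ '' (univ ×ˢ B))) (hA : MeasurableSet (Θ' '' (Φ ×ˢ B)))
    (hB : MeasurableSet B) (hΦ : MeasurableSet Φ) {r : ℝ} (hr : 0 < r) (hrB : Metric.ball (0 : V) r ⊆ B)
    {J : Z × V → ℝ} (hJm : Measurable J) (hJ0 : ∀ z ∈ Φ, ∀ y ∈ B, 0 ≤ J (z, y))
    (hJint : ∀ y ∈ B, IntegrableOn (fun z => J (z, y)) Φ κ)
    (hloc : μ.restrict (Θ' '' (Φ ×ˢ B)) =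
      (((κ.prod volume).restrict (Φ ×ˢ B)).withDensity fun w => ENNReal.ofReal (J w)).map Θ')
    (hc0 : ν (((e '' Φ) * S)⁻¹) ≠ 0) (hctop : ν (((e '' Φ) * S)⁻¹) ≠ ∞)
    {f φ : X → ℝ} {A : V →ₗ[ℝ] V} (hAs : A.IsSymmetric) (hpos : ∀ y, y ≠ 0 → 0 < ⟪A y, y⟫_ℝ)
    (hfm : Measurable f) (hφm : Measurable φ)
    (hfinv : ∀ (k : K) x, f (k • x) = f x) (hφinv : ∀ (k : K) x, φ (k • x) = φ x)
    (hS2 : (fun y => f (σ y) - f (σ 0) - (1 / 2) * ⟪A y, y⟫_ℝ) =o[𝓝 0] fun y => ‖y‖ ^ 2)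
    (hsep : ∀ δ : ℝ, 0 < δ → ∃ η : ℝ, 0 < η ∧ ∀ y ∈ B, δ ≤ ‖y‖ → f (σ 0) + η ≤ f (σ y))
    (hout : ∃ η₀ : ℝ, 0 < η₀ ∧ ∀ x, x ∉ Θ '' (univ ×ˢ B) → f (σ 0) + η₀ ≤ f x)
    (hj : ContinuousAt (fun y => ∫ z in Φ, J (z, y) ∂κ) 0) (hφc : ContinuousAt (fun y => φ (σ y)) 0)
    {δ₁ C : ℝ} (hδ₁ : 0 < δ₁) (hbound : ∀ y, ‖y‖ < δ₁ → |(∫ z in Φ, J (z, y) ∂κ) * φ (σ y)| ≤ C)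
    {β₀ : ℝ} (hint : Integrable (fun x => Real.exp (-β₀ * f x) * φ x) μ) :
    Tendsto (fun β : ℝ => β ^ ((finrank ℝ V : ℝ) / 2) *
        ∫ x, Real.exp (-β * (f x - f (σ 0))) * φ x ∂μ) atTop
      (𝓝 ((2 * π) ^ ((finrank ℝ V : ℝ) / 2) * (ν.real univ *
        ((∫ z in Φ, J (z, 0) ∂κ) / (ν (((e '' Φ) * S)⁻¹)).toReal * φ (σ 0) /
          Real.sqrt (LinearMap.det A))))) :=
  tendsto_laplaceMethod_orbit (act := fun (k : K) (x : X) => k • x)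
    (measurable_fst.smul measurable_snd) (fun k k' x => mul_smul k k' x) (fun x => one_smul K x)
    (fun k => measurePreserving_smul k μ) hσ hΘ hΘm hΘ' hΘ'm hslice hfix hT hA hB hΦ hr hrB hJm hJ0 hJint
    hloc hc0 hctop hAs hpos hfm hφm hfinv hφinv hS2 hsep hout hj hφc hδ₁ hbound hint

end Literature.Analysis.Asymptotics
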